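import Summits.Langlands.Langlands.Statement
import Literature.NumberTheory.Automorphic.RamakrishnanAsaiTransferGL2
import HarnessLib

/-!
# Line `AsaiGL3` — SPECIAL-CASE FILE (F3; forward generator G4 ladder-down, generation 26)
# top crux `ReciprocityUpToIrreducibility` (stmt-Langlands-14328)

The rung family `AsaiReciprocity N` (verbatim copy of `Lines/AsaiGL3.lean` §1), the reduction
`of_weakAsaiFunctoriality : WeakAsaiFunctoriality N → AsaiReciprocity N` and the FLOOR CELL `N = 2`:
`floor_two (h : Ramakrishnan2002_asaiTransfer_GL2) : AsaiReciprocity 2` — the named fact is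
`Literature.NumberTheory.Automorphic.Ramakrishnan2002_asaiTransfer_GL2 := WeakAsaiFunctoriality 2`
(Ramakrishnan 2002 Thm. D (a) / Krishnamurthy 2003; `Literature/NumberTheory/Automorphic/RamakrishnanAsaiTransferGL2.lean`,
p204438).  F3 instance: `example (h : Ramakrishnan2002_asaiTransfer_GL2) : AsaiGL2 := floor_two h`.  No `sorry`.
-/

noncomputable section

set_option linter.dupNamespace false

open scoped MatrixGroups Matrix NumberField Classical Polynomial
open Filter IsDedekindDomain Field Polynomial NumberField
open Literature.NumberTheory.Automorphic Literature.NumberTheory.GaloisRepresentations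
open Literature.NumberTheory.PAdicHodge
open Summit.Langlands

namespace Summit.Langlands.Langlands.Cruxes.ReciprocityUpToIrreducibility.AsaiGL3

/-! ## 1. The graded family (dial = the rank `N` on the `E`-side, target rank `N * N`) and the rung `N = 3` -/

/-- **The rung family** `AsaiReciprocity N`: clause (B) of the summit over EVERY number field `F`, every quadratic
extension `E/F` (non-trivial automorphism `c`), every `ℓ` and `ι : ℚ̄_ℓ ≃ ℂ`, in the a.e.-Satake form, for
irreducible `ρ : Γ_F → GL_{N²}(ℚ̄_ℓ)` de Rham above `ℓ` (pinned Fontaine datum `fontainePstAdicCompletion`) which, at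
all but finitely many places `v`, are unramified with Frobenius characteristic polynomial the `ι`-Satake polynomial
of every multiset `γ` whose Euler polynomial `∏ (1 - γ_k T)` is the unramified Asai polynomial
`asaiLocalPolynomial c A 1 w = det(1 - As(t_v) T)` (at split `v = w w̄`: `det(1 - t_w ⊗ t_{w̄} T)`; at inert `v`:
`∏_i (1 - a_i T) ∏_{i<j} (1 - a_i a_j T²)`) of a Satake family `A` that is an Asai datum (for SOME finite exceptional set `S`) of a CUSPIDAL `Π` on
`GL_N(𝔸_E)` — the unramified shadow of "`ρ ≅ As_{E/F}(ρ_Π)`".  Conclusion: an AUTOMORPHIC `P` on `GL_{N²}(𝔸_F)` (Borel–Jacquet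
datum, not asserted cuspidal) with `SatakeFrobCompatibleAt ι P ρ v` for almost all `v`.  Implied by the summit and
by E for every `N ≥ 1` (`…_of_langlands`, `…_of_top`); implied by `WeakAsaiFunctoriality N`
(`of_weakAsaiFunctoriality`), hence PROVED at `N = 2` modulo the named fact; OPEN at `N = 3` (`GL₃/E → GL₉/F`). -/
def AsaiReciprocity (N : ℕ) : Prop :=
  ∀ (F E : Type) [Field F] [NumberField F] [Field E] [NumberField E] [Algebra F E],
    Module.finrank F E = 2 → ∀ c : E ≃ₐ[F] E, c ≠ 1 →
    ∀ (hE : isCompact_glFiniteIntegralLevel N E) (piE : CuspidalAutomorphicRepData N E hE)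
      (A : SatakeFamily E), (∃ S : Set (HeightOneSpectrum (𝓞 F)), piE.1.IsAsaiDatum c S A) →
    ∀ (ℓ : ℕ) [Fact ℓ.Prime] (ι : PadicAlgCl ℓ ≃+* ℂ) (ρ : FramedGaloisRep F (PadicAlgCl ℓ) (N * N)),
      ρ.toGaloisRep.IsIrreducible →
      (∀ (v : HeightOneSpectrum (𝓞 F)) (hv : ((ℓ : ℕ) : 𝓞 F) ∈ v.asIdeal),
          (fontainePstAdicCompletion v ℓ hv).IsDeRhamFramed (ρ.toLocal v)) →
      (∀ᶠ v : HeightOneSpectrum (𝓞 F) in cofinite, ρ.IsUnramifiedAt v ∧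
          ∀ w : HeightOneSpectrum (𝓞 E), w.under (𝓞 F) = v →
            ∀ γ : Multiset ℂ, eulerPolynomial γ = asaiLocalPolynomial c A 1 w →
              ρ.HasFrobCharpolyAt v (arithFrobPolyOfSatake ι v.residueCard 1 γ)) →
      ∀ hF : isCompact_glFiniteIntegralLevel (N * N) F,
        ∃ P : AutomorphicRepData (AutomorphyDatum.gl (N * N) F hF),
          ∀ᶠ v : HeightOneSpectrum (𝓞 F) in cofinite, SatakeFrobCompatibleAt ι P ρ v

/-- **THE RUNG** (the filed statement): the family at `N = 3` — clause (B) for irreducible de Rham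
`GL₉`-representations of Asai type `As_{E/F}(GL₃)` over every number field and every quadratic `E/F`. -/
def AsaiGL3 : Prop := AsaiReciprocity 3

/-- The floor cell `N = 2` of the family as a decl (decided modulo the named fact, `floor_two`). -/
def AsaiGL2 : Prop := AsaiReciprocity 2

/-! ## 2. Weak Asai functoriality at `N` gives the rung family at `N` -/

/-- **`WeakAsaiFunctoriality N → AsaiReciprocity N`**: the automorphic a.e. Asai lift `P` of `(c, A)` has, at almost
every `v`, a Satake parameter `γ` with Euler polynomial the Asai polynomial above `v`, which is what the sector clause
says `ρ(Frob_v)` has as inverse-root data (a place `w ∣ v` exists: accepted `HeightOneSpectrum.exists_under_eq`).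
[folklore] -/
theorem of_weakAsaiFunctoriality {N : ℕ} (h : WeakAsaiFunctoriality N) : AsaiReciprocity N := by
  intro F E _ _ _ _ _ h2 c hc hE piE A hSA ℓ _ ι ρ _hirr _hdR hsec hF
  obtain ⟨S, hdat⟩ := hSA
  obtain ⟨P, hP⟩ := h F E h2 c hc hE piE S A hdat hF
  refine ⟨P, ?_⟩
  have hP' : ∀ᶠ v : HeightOneSpectrum (𝓞 F) in cofinite, ∀ w : HeightOneSpectrum (𝓞 E), w.under (𝓞 F) = v →
      ∃ γ : Multiset ℂ, P.HasSatakeParamAt v γ ∧ eulerPolynomial γ = asaiLocalPolynomial c A 1 w := hP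
  filter_upwards [hsec, hP'] with v hv hPv
  obtain ⟨hur, hcp⟩ := hv
  obtain ⟨w, hw⟩ := HeightOneSpectrum.exists_under_eq E v
  obtain ⟨γ, hγP, hγ⟩ := hPv w hw
  exact ⟨γ, hγP, hur, hcp w hw γ hγ⟩

/-! ## 3. The floor cell `N = 2` (Ramakrishnan 2002 Thm. D (a), named fact) -/

/-- **THE FLOOR `N = 2` (PROVED modulo the named fact)**: clause (B) for irreducible de Rham
`ρ : Γ_F → GL₄(ℚ̄_ℓ)` of Asai type `As_{E/F}(GL₂)`, over every number field and every quadratic `E/F` — THE WITNESS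
one step below the rung. [cite: Ramakrishnan2002, Theorem D (a)] -/
theorem floor_two (h : Ramakrishnan2002_asaiTransfer_GL2) : AsaiReciprocity 2 :=
  of_weakAsaiFunctoriality h

/-- F3 special-case instance at the floor cell `N = 2`. -/
example (h : Ramakrishnan2002_asaiTransfer_GL2) : AsaiGL2 := floor_two h


/-- F3, displayed form: the floor cell is the family at the witness value `N = 2`. -/
example (h : Ramakrishnan2002_asaiTransfer_GL2) : AsaiReciprocity 2 := by
  simpa [AsaiGL2] using (floor_two h : AsaiGL2)

end Summit.Langlands.Langlands.Cruxes.ReciprocityUpToIrreducibility.AsaiGL3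

end
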